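import Summits.QuantumFields.YangMills.Theorems.LuscherReductionOneSiteLevelsKacDefs
import Literature.Analysis.OperatorTheory.YangMillsMatrixModelQuasimodes

/-!
# INNER, flat lane (layer III): the admissible class `IsKacFn` of the min–max layer

Support module of crux `OneSiteLevels` (route `LuscherReduction`, item stmt-QuantumFields-20007), FLAT lane of the
registered v12 stub `stub_flatKacAL1` (STUB-PLAN rev 3 rows G1–G4, «min–max block»).

The min–max layer of the flat lane compares the energy form `𝔮(u) = ∫ ½‖∇u‖² + V u²` of functions that are NOT test
functions (AL1 eigenfunctions; heat-smoothed remainders `P_{t/2} r`) with the tree's min–max levels `physLevel k`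
(defined over `C²_c` colour-invariant trial functions).  This file fixes the admissible class and its algebra:

* §1 `IsKacFn u`: `u ∈ C²`, colour-invariant, `u, ∂u, ∂²u` bounded, `u ∈ L¹`, `∂_p u ∈ L²`, `V u² ∈ L¹` — the weakest
  bookkeeping under which every integral below is a genuine Bochner integral; it contains the AL1 eigenfunctions
  (`isKacFn_of_expDecay₂`) and (proved in the heat-flow module) the smoothed remainders; it is closed under `+`, `•`, `−`.
* the products of two members entering Green's identity (`u v`, `∂u ∂v`, `u ∂v`, `u ∂²v`, `V u v`, `u 𝔥v`) are integrable.
(The bilinear energy, polarisation and Green's identity on this class: companion file `…KacGreen.lean`.)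

Real analysis only ([folklore]); NOT the stub; femto rung R2b1; NOT a claim about the gap.
References: S. Agmon, Lectures on exponential decay (1982) (1.16); M. Reed, B. Simon IV, Thm. XIII.1–2.
-/

set_option autoImplicit false

noncomputable section

open MeasureTheory Filter Topology Real
open Literature.Analysis.OperatorTheory.YMMatrixModel

namespace Summit.QuantumFields.YangMills.Theorems.FemtoTransferGap

/-! ### §1. The admissible class -/

/-- **The admissible class of the flat lane's min–max layer.**  `u : ℝ⁹ → ℝ` is admissible if it is `C²`,
colour-rotation invariant, bounded together with its first and second partials, integrable, with square-integrable
first partials and `V u² ∈ L¹`.  (Contains the AL1 eigenfunctions and the heat-smoothed remainders; every product of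
members appearing in Green's identity is then integrable — the concrete stand-in for the form domain `Q(𝔥)`.)
[cite: ReedSimonIV1978, Thm. XIII.2] -/
def IsKacFn (u : ZM → ℝ) : Prop :=
  ContDiff ℝ 2 u ∧ IsGaugeInv u ∧
    (∃ C : ℝ, ∀ x, |u x| ≤ C ∧ (∀ p, |pderiv p u x| ≤ C) ∧ ∀ p q, |pderiv p (pderiv q u) x| ≤ C) ∧
    Integrable u ∧ (∀ p, Integrable fun x => pderiv p u x ^ 2) ∧ Integrable fun x => luscherPotential x * u x ^ 2

namespace IsKacFn

variable {u v : ZM → ℝ}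

/-- Field: `C²`. [folklore] -/
theorem contDiff (hu : IsKacFn u) : ContDiff ℝ 2 u := hu.1

/-- Field: colour-rotation invariance. [folklore] -/
theorem gaugeInv (hu : IsKacFn u) : IsGaugeInv u := hu.2.1

/-- Field: `u, ∂u, ∂²u` bounded. [folklore] -/
theorem bounded (hu : IsKacFn u) :
    ∃ C : ℝ, ∀ x, |u x| ≤ C ∧ (∀ p, |pderiv p u x| ≤ C) ∧ ∀ p q, |pderiv p (pderiv q u) x| ≤ C := hu.2.2.1

/-- Field: `u ∈ L¹`. [folklore] -/
theorem integrable (hu : IsKacFn u) : Integrable u := hu.2.2.2.1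

/-- Field: `∂_p u ∈ L²`. [folklore] -/
theorem integrable_pderiv_sq (hu : IsKacFn u) (p : Fin 3 × Fin 3) : Integrable fun x => pderiv p u x ^ 2 :=
  hu.2.2.2.2.1 p

/-- Field: `V u² ∈ L¹`. [folklore] -/
theorem integrable_potential_sq (hu : IsKacFn u) : Integrable fun x => luscherPotential x * u x ^ 2 := hu.2.2.2.2.2

/-- Members are differentiable. [folklore] -/
theorem differentiable (hu : IsKacFn u) : Differentiable ℝ u := differentiable_of_contDiff_two hu.contDiff

/-- Members are continuous. [folklore] -/
theorem continuous (hu : IsKacFn u) : Continuous u := hu.contDiff.continuous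

/-- The partials of a member are differentiable. [folklore] -/
theorem differentiable_pderiv (hu : IsKacFn u) (p : Fin 3 × Fin 3) : Differentiable ℝ (pderiv p u) :=
  differentiable_pderiv_of_contDiff_two hu.contDiff p

/-- The partials of a member are continuous. [folklore] -/
theorem continuous_pderiv (hu : IsKacFn u) (p : Fin 3 × Fin 3) : Continuous (pderiv p u) :=
  continuous_pderiv_of_contDiff_two hu.contDiff p

/-- The second partials of a member are continuous. [folklore] -/
theorem continuous_pderiv_pderiv (hu : IsKacFn u) (p q : Fin 3 × Fin 3) : Continuous (pderiv p (pderiv q u)) :=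
  continuous_pderiv_pderiv_of_contDiff_two hu.contDiff p q

/-- A nonnegative bound for `u`, `∂u`, `∂²u`. [folklore] -/
theorem exists_bound (hu : IsKacFn u) : ∃ C : ℝ, 0 ≤ C ∧
    ∀ x, |u x| ≤ C ∧ (∀ p, |pderiv p u x| ≤ C) ∧ ∀ p q, |pderiv p (pderiv q u) x| ≤ C := by
  obtain ⟨C, hC⟩ := hu.bounded
  exact ⟨C, (abs_nonneg _).trans (hC 0).1, hC⟩

/-- `u² ∈ L¹` (bounded and integrable). [folklore] -/
theorem integrable_sq (hu : IsKacFn u) : Integrable fun x => u x ^ 2 := by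
  obtain ⟨C, _, hC⟩ := hu.exists_bound
  have h := hu.integrable.bdd_mul (c := C) hu.continuous.aestronglyMeasurable
    (ae_of_all _ fun x => by rw [Real.norm_eq_abs]; exact (hC x).1)
  exact h.congr (ae_of_all _ fun x => by simp [sq])

/-- `u ∈ L²`. [folklore] -/
theorem memLp_two (hu : IsKacFn u) : MemLp u 2 volume :=
  (memLp_two_iff_integrable_sq hu.continuous.aestronglyMeasurable).2 hu.integrable_sq

/-- `l2sq u = ∫ u²` is the honest integral. [folklore] -/
theorem l2sq_eq (u : ZM → ℝ) : l2sq u = ∫ x, u x ^ 2 := rfl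

end IsKacFn

/-! #### Integrability of the products of two members -/

section Products

variable {u v : ZM → ℝ}

/-- AM–GM domination: if `a², b² ∈ L¹` (measurable `a, b`) then `a·b ∈ L¹`. [folklore] -/
theorem integrable_mul_of_sq {a b : ZM → ℝ} (ha : AEStronglyMeasurable a volume) (hb : AEStronglyMeasurable b volume)
    (ha2 : Integrable fun x => a x ^ 2) (hb2 : Integrable fun x => b x ^ 2) :
    Integrable fun x => a x * b x := by
  refine ((ha2.add hb2).div_const 2).mono' (ha.mul hb) (ae_of_all _ fun x => ?_)
  simp only [Real.norm_eq_abs, abs_mul, Pi.add_apply]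
  nlinarith [sq_nonneg (|a x| - |b x|), abs_mul_abs_self (a x), abs_mul_abs_self (b x),
    abs_nonneg (a x), abs_nonneg (b x)]

/-- `u · v ∈ L¹` for members. [folklore] -/
theorem IsKacFn.integrable_mul (hu : IsKacFn u) (hv : IsKacFn v) : Integrable fun x => u x * v x := by
  obtain ⟨C, _, hC⟩ := hv.exists_bound
  exact hu.integrable.mul_bdd (c := C) hv.continuous.aestronglyMeasurable
    (ae_of_all _ fun x => by rw [Real.norm_eq_abs]; exact (hC x).1)

/-- `∂_p u · ∂_q v ∈ L¹` for members. [folklore] -/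
theorem IsKacFn.integrable_pderiv_mul_pderiv (hu : IsKacFn u) (hv : IsKacFn v) (p q : Fin 3 × Fin 3) :
    Integrable fun x => pderiv p u x * pderiv q v x :=
  integrable_mul_of_sq (hu.continuous_pderiv p).aestronglyMeasurable (hv.continuous_pderiv q).aestronglyMeasurable
    (hu.integrable_pderiv_sq p) (hv.integrable_pderiv_sq q)

/-- `u · ∂_p v ∈ L¹` for members. [folklore] -/
theorem IsKacFn.integrable_mul_pderiv (hu : IsKacFn u) (hv : IsKacFn v) (p : Fin 3 × Fin 3) :
    Integrable fun x => u x * pderiv p v x := by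
  obtain ⟨C, _, hC⟩ := hv.exists_bound
  exact hu.integrable.mul_bdd (c := C) (hv.continuous_pderiv p).aestronglyMeasurable
    (ae_of_all _ fun x => by rw [Real.norm_eq_abs]; exact (hC x).2.1 p)

/-- `u · ∂_p∂_q v ∈ L¹` for members. [folklore] -/
theorem IsKacFn.integrable_mul_pderiv_pderiv (hu : IsKacFn u) (hv : IsKacFn v) (p q : Fin 3 × Fin 3) :
    Integrable fun x => u x * pderiv p (pderiv q v) x := by
  obtain ⟨C, _, hC⟩ := hv.exists_bound
  exact hu.integrable.mul_bdd (c := C) (hv.continuous_pderiv_pderiv p q).aestronglyMeasurable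
    (ae_of_all _ fun x => by rw [Real.norm_eq_abs]; exact (hC x).2.2 p q)

/-- `V u v ∈ L¹` for members (`|V u v| ≤ ½ V (u² + v²)`, `V ≥ 0`). [folklore] -/
theorem IsKacFn.integrable_potential_mul (hu : IsKacFn u) (hv : IsKacFn v) :
    Integrable fun x => luscherPotential x * (u x * v x) := by
  refine ((hu.integrable_potential_sq.add hv.integrable_potential_sq).div_const 2).mono'
    ((continuous_luscherPotential.mul (hu.continuous.mul hv.continuous)).aestronglyMeasurable)
    (ae_of_all _ fun x => ?_)
  rw [Real.norm_eq_abs, abs_mul, abs_of_nonneg (luscherPotential_nonneg x), abs_mul]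
  have hV := luscherPotential_nonneg x
  have h1 : |u x| * |v x| ≤ (u x ^ 2 + v x ^ 2) / 2 := by
    nlinarith [sq_nonneg (|u x| - |v x|), abs_mul_abs_self (u x), abs_mul_abs_self (v x)]
  calc luscherPotential x * (|u x| * |v x|) ≤ luscherPotential x * ((u x ^ 2 + v x ^ 2) / 2) :=
        mul_le_mul_of_nonneg_left h1 hV
    _ = (luscherPotential x * u x ^ 2 + luscherPotential x * v x ^ 2) / 2 := by ring

/-- `u · 𝔥v ∈ L¹` for members. [folklore] -/
theorem IsKacFn.integrable_mul_hApply (hu : IsKacFn u) (hv : IsKacFn v) :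
    Integrable fun x => u x * hApply v x := by
  have h1 : Integrable fun x => ∑ p, u x * pderiv p (pderiv p v) x :=
    integrable_finsetSum _ fun p _ => hu.integrable_mul_pderiv_pderiv hv p p
  have h2 := hu.integrable_potential_mul hv
  refine ((h1.const_mul (-(1 / 2 : ℝ))).add h2).congr (ae_of_all _ fun x => ?_)
  show -(1 / 2 : ℝ) * (∑ p, u x * pderiv p (pderiv p v) x) + luscherPotential x * (u x * v x) = u x * hApply v x
  rw [hApply_def, laplacian_def, ← Finset.mul_sum]
  ring

end Products

/-! #### Membership and closure -/

section Closure

variable {u v : ZM → ℝ}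

/-- Lagrange: `|x_i × x_j|² ≤ |x_i|² |x_j|²`. [folklore] -/
theorem crossSq_le_csq_mul_csq (i j : Fin 3) (x : ZM) : crossSq i j x ≤ csq i x * csq j x := by
  rw [crossSq, cross_dot_cross, csq, csq, dotProduct_comm (colourVec x j) (colourVec x i)]
  nlinarith [mul_self_nonneg (colourVec x i ⬝ᵥ colourVec x j)]

/-- The quartic growth of the potential: `V(x) ≤ ¼ ‖x‖⁴`. [folklore] -/
theorem luscherPotential_le_norm_pow_four (x : ZM) : luscherPotential x ≤ (1 / 4 : ℝ) * ‖x‖ ^ 4 := by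
  rw [luscherPotential_eq_sum_crossSq]
  have hn : ‖x‖ ^ 4 = (∑ i, csq i x) * ∑ j, csq j x := by
    rw [show (4:ℕ) = 2 * 2 from rfl, pow_mul, norm_sq_eq_sum_csq, sq]
  rw [hn, Finset.sum_mul_sum]
  gcongr with i _ j _
  exact crossSq_le_csq_mul_csq i j x

/-- **AL1-type functions are admissible**: `C²`, invariant, `ExpDecay₂` ⇒ `IsKacFn`. [cite: Agmon1982, Cor. 4.5] -/
theorem isKacFn_of_expDecay₂ (h2 : ContDiff ℝ 2 u) (hg : IsGaugeInv u) (hd : ExpDecay₂ u) : IsKacFn u := by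
  obtain ⟨C, hC0, hC⟩ := hd.exists_nonneg
  have hexp1 : ∀ x : ZM, Real.exp (-‖x‖) ≤ 1 := fun x =>
    Real.exp_le_one_iff.mpr (neg_nonpos.mpr (norm_nonneg x))
  have hcont : Continuous u := h2.continuous
  have hint : Integrable u := by
    refine (integrable_exp_neg_norm.const_mul C).mono' hcont.aestronglyMeasurable (ae_of_all _ fun x => ?_)
    rw [Real.norm_eq_abs]; exact (hC x).1
  refine ⟨h2, hg, ⟨C, fun x => ⟨?_, fun p => ?_, fun p q => ?_⟩⟩, hint, fun p => ?_, ?_⟩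
  · exact ((hC x).1).trans (by nlinarith [hexp1 x])
  · exact ((hC x).2.1 p).trans (by nlinarith [hexp1 x])
  · exact ((hC x).2.2 p q).trans (by nlinarith [hexp1 x])
  · -- `(∂u)² ≤ C² e^{-2‖x‖} ≤ C² e^{-‖x‖}`
    refine (integrable_exp_neg_norm.const_mul (C ^ 2)).mono'
      ((continuous_pderiv_of_contDiff_two h2 p).pow 2).aestronglyMeasurable (ae_of_all _ fun x => ?_)
    rw [Real.norm_eq_abs, abs_of_nonneg (sq_nonneg _)]
    have h := (hC x).2.1 p
    have hsq : pderiv p u x ^ 2 ≤ (C * Real.exp (-‖x‖)) ^ 2 := by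
      rw [← sq_abs]; exact pow_le_pow_left₀ (abs_nonneg _) h 2
    calc pderiv p u x ^ 2 ≤ (C * Real.exp (-‖x‖)) ^ 2 := hsq
      _ = C ^ 2 * Real.exp (-‖x‖) * Real.exp (-‖x‖) := by ring
      _ ≤ C ^ 2 * Real.exp (-‖x‖) * 1 := by gcongr; exact hexp1 x
      _ = C ^ 2 * Real.exp (-‖x‖) := mul_one _
  · -- `V u² ≤ ¼‖x‖⁴ C² e^{-2‖x‖} ≤ 6 C² e^{-‖x‖}`
    refine (integrable_exp_neg_norm.const_mul (6 * C ^ 2)).mono'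
      (continuous_luscherPotential.mul (hcont.pow 2)).aestronglyMeasurable (ae_of_all _ fun x => ?_)
    rw [Real.norm_eq_abs, abs_of_nonneg (mul_nonneg (luscherPotential_nonneg x) (sq_nonneg _))]
    have hV := luscherPotential_le_norm_pow_four x
    have hV0 := luscherPotential_nonneg x
    have hsq : u x ^ 2 ≤ (C * Real.exp (-‖x‖)) ^ 2 := by
      rw [← sq_abs]; exact pow_le_pow_left₀ (abs_nonneg _) (hC x).1 2
    have h24 : ‖x‖ ^ 4 * Real.exp (-‖x‖) ≤ 24 := by
      -- `s⁴/4! ≤ e^s` (the same elementary bound as the sieve library's `pow_four_mul_exp_neg_le`)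
      have h := Real.pow_div_factorial_le_exp ‖x‖ (norm_nonneg x) 4
      have h4 : (Nat.factorial 4 : ℝ) = 24 := by norm_num [Nat.factorial]
      rw [h4, div_le_iff₀ (by norm_num : (0:ℝ) < 24)] at h
      rw [Real.exp_neg, mul_inv_le_iff₀ (Real.exp_pos _)]
      linarith
    have he := Real.exp_pos (-‖x‖)
    calc luscherPotential x * u x ^ 2 ≤ (1 / 4 : ℝ) * ‖x‖ ^ 4 * (C * Real.exp (-‖x‖)) ^ 2 :=
          mul_le_mul hV hsq (sq_nonneg _) (by positivity)
      _ = (1 / 4 : ℝ) * C ^ 2 * (‖x‖ ^ 4 * Real.exp (-‖x‖)) * Real.exp (-‖x‖) := by ring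
      _ ≤ (1 / 4 : ℝ) * C ^ 2 * 24 * Real.exp (-‖x‖) := by gcongr
      _ = 6 * C ^ 2 * Real.exp (-‖x‖) := by ring

/-- The members of an AL1 eigenfamily are admissible. [cite: ReedSimonIV1978, Thm. XIII.64] -/
theorem isKacFn_of_isEigenFamily {m : ℕ} {f : Fin (m + 1) → ZM → ℝ} (hf : IsEigenFamily m f) (j : Fin (m + 1)) :
    IsKacFn (f j) :=
  isKacFn_of_expDecay₂ (hf.1 j 2) (hf.2.1 j) (hf.2.2.2.2 j)

/-- `∂_p (u + v) = ∂_p u + ∂_p v` for differentiable `u, v`. [folklore] -/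
theorem pderiv_add {u v : ZM → ℝ} (hu : Differentiable ℝ u) (hv : Differentiable ℝ v) (p : Fin 3 × Fin 3) :
    pderiv p (u + v) = fun x => pderiv p u x + pderiv p v x := by
  funext x
  rw [pderiv, fderiv_add (hu x) (hv x)]
  rfl

/-- `∂_p (a • u) = a · ∂_p u`. [folklore] -/
theorem pderiv_smul {u : ZM → ℝ} (a : ℝ) (p : Fin 3 × Fin 3) :
    pderiv p (a • u) = fun x => a * pderiv p u x := by
  funext x
  rw [pderiv, pderiv, fderiv_const_smul_field]
  rfl

/-- The class is closed under addition. [folklore] -/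
theorem IsKacFn.add (hu : IsKacFn u) (hv : IsKacFn v) : IsKacFn (u + v) := by
  obtain ⟨Cu, _, hCu⟩ := hu.exists_bound
  obtain ⟨Cv, _, hCv⟩ := hv.exists_bound
  have hd1 : ∀ p, pderiv p (u + v) = fun x => pderiv p u x + pderiv p v x :=
    fun p => pderiv_add hu.differentiable hv.differentiable p
  have hd2 : ∀ p q, pderiv p (pderiv q (u + v)) = fun x => pderiv p (pderiv q u) x + pderiv p (pderiv q v) x := by
    intro p q
    rw [hd1 q]
    exact pderiv_add (hu.differentiable_pderiv q) (hv.differentiable_pderiv q) p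
  refine ⟨hu.contDiff.add hv.contDiff, hu.gaugeInv.add hv.gaugeInv, ⟨Cu + Cv, fun x => ⟨?_, fun p => ?_, fun p q => ?_⟩⟩,
    hu.integrable.add hv.integrable, fun p => ?_, ?_⟩
  · simpa using (abs_add_le (u x) (v x)).trans (add_le_add (hCu x).1 (hCv x).1)
  · rw [hd1 p]; exact (abs_add_le _ _).trans (add_le_add ((hCu x).2.1 p) ((hCv x).2.1 p))
  · rw [hd2 p q]; exact (abs_add_le _ _).trans (add_le_add ((hCu x).2.2 p q) ((hCv x).2.2 p q))
  · rw [hd1 p]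
    refine (((hu.integrable_pderiv_sq p).add (hv.integrable_pderiv_sq p)).const_mul 2).mono'
      (((hu.continuous_pderiv p).add (hv.continuous_pderiv p)).pow 2).aestronglyMeasurable (ae_of_all _ fun x => ?_)
    simp only [Real.norm_eq_abs, Pi.add_apply]
    rw [abs_of_nonneg (sq_nonneg _)]
    nlinarith [sq_nonneg (pderiv p u x - pderiv p v x)]
  · refine (((hu.integrable_potential_sq).add (hv.integrable_potential_sq)).const_mul 2).mono'
      (continuous_luscherPotential.mul ((hu.continuous.add hv.continuous).pow 2)).aestronglyMeasurable
      (ae_of_all _ fun x => ?_)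
    simp only [Real.norm_eq_abs, abs_of_nonneg (mul_nonneg (luscherPotential_nonneg x) (sq_nonneg _)), Pi.add_apply]
    have hV := luscherPotential_nonneg x
    have : (u x + v x) ^ 2 ≤ 2 * (u x ^ 2 + v x ^ 2) := by nlinarith [sq_nonneg (u x - v x)]
    nlinarith [mul_le_mul_of_nonneg_left this hV]

/-- The class is closed under scalar multiplication. [folklore] -/
theorem IsKacFn.smul (hu : IsKacFn u) (a : ℝ) : IsKacFn (a • u) := by
  obtain ⟨C, hC0, hC⟩ := hu.exists_bound
  have hd1 : ∀ p, pderiv p (a • u) = fun x => a * pderiv p u x := fun p => pderiv_smul a p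
  have hd2 : ∀ p q, pderiv p (pderiv q (a • u)) = fun x => a * pderiv p (pderiv q u) x := by
    intro p q
    rw [hd1 q]
    exact pderiv_smul (u := pderiv q u) a p
  refine ⟨hu.contDiff.const_smul a, hu.gaugeInv.smul a, ⟨|a| * C, fun x => ⟨?_, fun p => ?_, fun p q => ?_⟩⟩,
    hu.integrable.smul a, fun p => ?_, ?_⟩
  · simp only [Pi.smul_apply, smul_eq_mul, abs_mul]; exact mul_le_mul_of_nonneg_left (hC x).1 (abs_nonneg a)
  · rw [hd1 p, abs_mul]; exact mul_le_mul_of_nonneg_left ((hC x).2.1 p) (abs_nonneg a)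
  · rw [hd2 p q, abs_mul]; exact mul_le_mul_of_nonneg_left ((hC x).2.2 p q) (abs_nonneg a)
  · rw [hd1 p]
    exact ((hu.integrable_pderiv_sq p).const_mul (a ^ 2)).congr (ae_of_all _ fun x => by simp only; ring)
  · exact (hu.integrable_potential_sq.const_mul (a ^ 2)).congr (ae_of_all _ fun x => by
      simp only [Pi.smul_apply, smul_eq_mul]; ring)

/-- The class is closed under negation. [folklore] -/
theorem IsKacFn.neg (hu : IsKacFn u) : IsKacFn (-u) := by
  have h := hu.smul (-1)
  have e : ((-1 : ℝ) • u) = -u := by funext x; simp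
  rwa [e] at h

/-- The class is closed under subtraction. [folklore] -/
theorem IsKacFn.sub (hu : IsKacFn u) (hv : IsKacFn v) : IsKacFn (u - v) := by
  rw [sub_eq_add_neg]; exact hu.add hv.neg

/-- `0` is admissible. [folklore] -/
theorem isKacFn_zero : IsKacFn (0 : ZM → ℝ) := by
  have hz : ∀ p, pderiv p (0 : ZM → ℝ) = 0 := fun p => by
    funext x; simp [pderiv]
  refine ⟨contDiff_const, isGaugeInv_zero, ⟨0, fun x => ⟨by simp, fun p => by simp [hz], fun p q => by simp [hz]⟩⟩,
    integrable_zero _ _ _, fun p => by simp [hz], by simp⟩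

/-- Finite linear combinations of members are members. [folklore] -/
theorem isKacFn_sum_smul {ι : Type*} (s : Finset ι) (f : ι → ZM → ℝ) (hf : ∀ i, IsKacFn (f i)) (c : ι → ℝ) :
    IsKacFn (fun x => ∑ i ∈ s, c i * f i x) := by
  classical
  induction s using Finset.induction_on with
  | empty =>
    have e : (fun x : ZM => ∑ i ∈ (∅ : Finset ι), c i * f i x) = 0 := by funext x; simp
    rw [e]; exact isKacFn_zero
  | insert a s ha ih =>
    have e : (fun x => ∑ i ∈ insert a s, c i * f i x) = (c a • f a) + fun x => ∑ i ∈ s, c i * f i x := by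
      funext x; simp [Finset.sum_insert ha]
    rw [e]
    exact ((hf a).smul (c a)).add ih

/-- The span of an eigenfamily lies in the class. [cite: ReedSimonIV1978, Thm. XIII.64] -/
theorem isKacFn_span {m : ℕ} {f : Fin (m + 1) → ZM → ℝ} (hf : IsEigenFamily m f) (c : Fin (m + 1) → ℝ) :
    IsKacFn (fun x => ∑ j, c j * f j x) :=
  isKacFn_sum_smul Finset.univ f (isKacFn_of_isEigenFamily hf) c

end Closure

end Summit.QuantumFields.YangMills.Theorems.FemtoTransferGap

end
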